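import Summits.QuantumFields.YangMills.Theorems.SwapVirialDeficitBlowUpGnomonicFollowerCoercivity
import Summits.QuantumFields.YangMills.Theorems.SwapVirialDeficitBlowUpGnomonicLeadersWeight
import Summits.QuantumFields.YangMills.Theorems.SwapVirialDeficitBlowUpSignPatternsLargeField
import Summits.QuantumFields.YangMills.Theorems.SwapVirialDeficitGnomonicTaylorLine
import Summits.QuantumFields.YangMills.Theorems.SwapVirialDeficitGnomonicDeficitSmooth
import HarnessLib

/-!
# W3, core: THE FULL FIBRE HESSIAN AT A GNOMONIC BASE POINT IS COERCIVE — `μ′·N(ξ) ≤ (d²/ds²) F̂(η₀ + s·ξ)|₀` for every fibre direction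
# `ξ = (x_⊥, y_⊥, z, η_F)` (`2α = 18L⁴ − 2` dimensions), principal sector, `μ′ = poly(L)⁻¹·min(sin²2ψ/(2+x₀²), sin²ψ/(2+y₀²), 1)` — RAY form, no Hessian operator
# (free-hands support of ⟨stmt-QuantumFields-24197⟩ `SwapVirialDeficit.SwapGluedStiffness`; W3 bullet 4 «`A(p) ≥ λ(ψ₀)/poly` on `B` from ✓hubStiff + ✓chartBox» of LEAD
# ym-line-sfw-p2 g97's steep-window Morse–Bott plan, done with ✓`gauge_coercive_of_growth_offset_half` instead of `hess_nonneg_of_isMinOn`)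

Base point `η₀ = ((x₀e₀, y₀e₀), 0, 0)` (hub `a ≠ 0`, signs `ε` with follower signs `+`), fibre directions `ξ(w) = ((0,u₁,u₂), (0,v₁,v₂), z, η_F)` parametrised by
`w = ((u, v), z, η_F) ∈ W := (ℝ² × ℝ²) × ℝ³ × (ℝ³)^{Fol L}`, gauge `N(w) = |u|² + |v|² + |z|² + Σ_f|η_f|²` (✓`fibreSq_eulerDilate`'s gauge).  GROWTH on `{N ≤ 1}`:
✓`leadersW_hubStiff_le` (`s₂ψ²·gnoWtr(x) + sψ²·gnoWtr(y) + gnomonicW(z) ≤ 16200L⁶F̂`, `s₂ψ = 2cosψ sinψ`, `sψ = sinψ` of the hub) with the homogeneous minorants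
`gnoWtr(x₀,u) ≥ 4|u|²/(2+x₀²)`, `gnomonicW(z) ≥ 2|z|²` (`gnoWtr_ge_of_le_one`, `gnomonicW_ge_of_le_one`), plus ✓`gnoFollower_growth` (`κ_F = 1/(2304L⁶|Fol|)`);
REMAINDER `B₄ = 63540000L⁴` from fcl-p3 g47's ✓`taylor_four_gnoDeficit_line` (letter sizes of `ξ(w)` are `≤ √N(w)`); rays `C^∞` by ✓`contDiff_gnoDeficit`;
homogeneity ✓`raySecond_homogeneous`; parity ✓`deriv_ray_neg` &c.  Result:
* `fibreDir_smul`, `fibreGauge_smul`, `eq_zero_of_fibreGauge_eq_zero`, `gnoWtr_ge_of_le_one`, `gnomonicW_ge_of_le_one`, `letterSizes_fibreDir_le`;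
* ★★ `fibre_growth_gnomonic` — `μ′·N(w) ≤ F̂(η₀ + ξ(w))` on `{N ≤ 1}` for any `μ′ ≤ ½·min(κ_x, κ_y, κ_z, κ_F)` (stated as four inequalities);
* ★★ `fibre_ray_remainder_four` — the quartic ray remainder along `ξ(w)` is `≤ 63540000L⁴·N(w)²`;
* ★★★ `fibre_raySecond_coercive_gnomonic` — `0 < R ≤ 1`, `2·F̂(η₀) ≤ μ′R²/2` (free on the exactly-flat base), `2·63540000L⁴·R² ≤ μ′/2` ⟹
  `μ′·N(w) ≤ (d²/ds²) gnoDeficit 0 1 a ε (η₀ + s·ξ(w))|₀` for EVERY `w` — the fibre Hessian at the base point is `μ′`-coercive, `μ′ = poly(L)⁻¹` on the bulk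
  `{ψ₀ ≤ ψ ≤ π/2 − ψ₀, |x₀|,|y₀| ≤ V₀}` exactly as in (B-bulk).
What is NOT here: sector `001` (needs a signed hub-stiffness floor), the Hessian-operator ∕ `EuclideanSpace` packaging, the Lipschitz transfer to nearby fibre points (w2 ✓).

HONEST LABEL: composition of landed results; ⟨24197⟩ (window-uniform) ∕ ⟨24196⟩ ∕ ⟨24194⟩ ∕ ⟨24497⟩ OPEN; own crux ⟨22884⟩ OPEN (blocked-on ⟨19935⟩); no crux, rung of record or
summit is proved; the Yang–Mills mass gap is NOT proved; no summit is proved by a line.  THEOREMS ONLY (0 `def`, 0 `sorry`), standard axioms.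
Width seat ym-line-sfw-p2-w3 g65 (cell ym-idea-1, free hands), `--supports stmt-QuantumFields-24197`.  References: [cite: Luscher1983, §2]; [folklore].
-/

set_option autoImplicit false

noncomputable section

open MeasureTheory Quaternion
open scoped BigOperators Quaternion ContDiff
open Literature.MathematicalPhysics.QuantumFieldTheory hiding SU2
open Literature.MathematicalPhysics.QuantumLattice

namespace Summit.QuantumFields.YangMills.Theorems.SwapVirialDeficit.BlowUpRing

open Summit.QuantumFields.YangMills.Theorems.FemtoTransferGap
open Summit.QuantumFields.YangMills.Theorems.FemtoTransferGap.TT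
open Summit.QuantumFields.YangMills.Theorems.VirialFluxGap.RingDeficit
open Summit.QuantumFields.YangMills.Theorems.SwapVirialDeficit.SwapRing
open Summit.QuantumFields.YangMills.Theorems.SwapVirialDeficit.Gnomonic (normSq3 normSq3_nonneg normSq3_smul gnomonicW taylor_four_gnoDeficit_line contDiff_gnoDeficit)
open Summit.QuantumFields.YangMills.Theorems.QuantitativeLaplace (gauge_coercive_of_growth_offset_half raySecond_homogeneous deriv_ray_neg iteratedDeriv_two_ray_neg
  iteratedDeriv_three_ray_neg)

variable {L : ℕ} [NeZero L]

/-! ## §1 Fibre directions, the gauge, the minorants -/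

omit [NeZero L] in
/-- The fibre direction `ξ(w) = ((0,u₁,u₂), (0,v₁,v₂), z, η_F)` is linear in `w`: `ξ(t•w) = t•ξ(w)`. [folklore] -/
theorem fibreDir_smul (t : ℝ) (w : ((Fin 2 → ℝ) × (Fin 2 → ℝ)) × (Fin 3 → ℝ) × (Fol L → Fin 3 → ℝ)) :
    ((((![0, (t • w).1.1 0, (t • w).1.1 1] : Fin 3 → ℝ), (![0, (t • w).1.2 0, (t • w).1.2 1] : Fin 3 → ℝ)), ((t • w).2.1, (t • w).2.2)) : GnoCoord L) =
      t • ((((![0, w.1.1 0, w.1.1 1] : Fin 3 → ℝ), (![0, w.1.2 0, w.1.2 1] : Fin 3 → ℝ)), (w.2.1, w.2.2)) : GnoCoord L) := by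
  refine Prod.ext (Prod.ext ?_ ?_) (Prod.ext rfl rfl)
  · funext k; fin_cases k <;> simp
  · funext k; fin_cases k <;> simp

/-- The fibre gauge `N(w) = |u|² + |v|² + |z|² + Σ_f|η_f|²` is homogeneous of degree two. [folklore] -/
theorem fibreGauge_smul (t : ℝ) (w : ((Fin 2 → ℝ) × (Fin 2 → ℝ)) × (Fin 3 → ℝ) × (Fol L → Fin 3 → ℝ)) :
    ((t • w).1.1 0 ^ 2 + (t • w).1.1 1 ^ 2 + ((t • w).1.2 0 ^ 2 + (t • w).1.2 1 ^ 2) + normSq3 (t • w).2.1 + ∑ f, normSq3 ((t • w).2.2 f)) =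
      t ^ 2 * (w.1.1 0 ^ 2 + w.1.1 1 ^ 2 + (w.1.2 0 ^ 2 + w.1.2 1 ^ 2) + normSq3 w.2.1 + ∑ f, normSq3 (w.2.2 f)) := by
  simp only [Prod.smul_fst, Prod.smul_snd, Pi.smul_apply, smul_eq_mul, normSq3_smul]
  rw [← Finset.mul_sum]; ring

/-- The fibre gauge is non-negative. [folklore] -/
theorem fibreGauge_nonneg (w : ((Fin 2 → ℝ) × (Fin 2 → ℝ)) × (Fin 3 → ℝ) × (Fol L → Fin 3 → ℝ)) :
    0 ≤ w.1.1 0 ^ 2 + w.1.1 1 ^ 2 + (w.1.2 0 ^ 2 + w.1.2 1 ^ 2) + normSq3 w.2.1 + ∑ f, normSq3 (w.2.2 f) := by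
  have h1 := normSq3_nonneg w.2.1
  have h2 : 0 ≤ ∑ f, normSq3 (w.2.2 f) := Finset.sum_nonneg fun f _ => normSq3_nonneg _
  positivity

/-- The fibre gauge is definite. [folklore] -/
theorem eq_zero_of_fibreGauge_eq_zero (w : ((Fin 2 → ℝ) × (Fin 2 → ℝ)) × (Fin 3 → ℝ) × (Fol L → Fin 3 → ℝ))
    (h : w.1.1 0 ^ 2 + w.1.1 1 ^ 2 + (w.1.2 0 ^ 2 + w.1.2 1 ^ 2) + normSq3 w.2.1 + ∑ f, normSq3 (w.2.2 f) = 0) : w = 0 := by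
  have h1 := normSq3_nonneg w.2.1
  have h2 : 0 ≤ ∑ f, normSq3 (w.2.2 f) := Finset.sum_nonneg fun f _ => normSq3_nonneg _
  have hu0 : w.1.1 0 = 0 := by nlinarith [sq_nonneg (w.1.1 0), sq_nonneg (w.1.1 1), sq_nonneg (w.1.2 0), sq_nonneg (w.1.2 1)]
  have hu1 : w.1.1 1 = 0 := by nlinarith [sq_nonneg (w.1.1 0), sq_nonneg (w.1.1 1), sq_nonneg (w.1.2 0), sq_nonneg (w.1.2 1)]
  have hv0 : w.1.2 0 = 0 := by nlinarith [sq_nonneg (w.1.1 0), sq_nonneg (w.1.1 1), sq_nonneg (w.1.2 0), sq_nonneg (w.1.2 1)]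
  have hv1 : w.1.2 1 = 0 := by nlinarith [sq_nonneg (w.1.1 0), sq_nonneg (w.1.1 1), sq_nonneg (w.1.2 0), sq_nonneg (w.1.2 1)]
  have hz : normSq3 w.2.1 = 0 := by nlinarith [sq_nonneg (w.1.1 0), sq_nonneg (w.1.1 1), sq_nonneg (w.1.2 0), sq_nonneg (w.1.2 1)]
  have hF : ∑ f, normSq3 (w.2.2 f) = 0 := by nlinarith [sq_nonneg (w.1.1 0), sq_nonneg (w.1.1 1), sq_nonneg (w.1.2 0), sq_nonneg (w.1.2 1)]
  have hz' : w.2.1 = 0 := by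
    funext k
    have := (Finset.sum_eq_zero_iff_of_nonneg fun j _ => sq_nonneg (w.2.1 j)).1 hz k (Finset.mem_univ k)
    simpa using this
  have hF' : w.2.2 = 0 := eq_zero_of_sum_normSq3_eq_zero w.2.2 hF
  refine Prod.ext (Prod.ext ?_ ?_) (Prod.ext hz' hF')
  · funext k; fin_cases k <;> simp [hu0, hu1]
  · funext k; fin_cases k <;> simp [hv0, hv1]

omit [NeZero L] in
/-- The transverse Euler weight dominates `4|x_⊥|²/(2 + x₀²)` on the unit box `|x_⊥|² ≤ 1`. [folklore] -/
theorem gnoWtr_ge_of_le_one (x₀ u₁ u₂ : ℝ) (h : u₁ ^ 2 + u₂ ^ 2 ≤ 1) :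
    4 * (u₁ ^ 2 + u₂ ^ 2) / (2 + x₀ ^ 2) ≤ gnoWtr (![x₀, u₁, u₂] : Fin 3 → ℝ) := by
  rw [gnoWtr]
  simp only [Fin.sum_univ_three, Matrix.cons_val_zero, Matrix.cons_val_one, Matrix.cons_val_two, Matrix.head_cons, Matrix.tail_cons]
  have h0 : 0 ≤ u₁ ^ 2 + u₂ ^ 2 := by positivity
  rw [div_le_div_iff₀ (by positivity) (by positivity)]
  nlinarith [sq_nonneg x₀]

omit [NeZero L] in
/-- The full Euler weight dominates `2|z|²` on the unit box `|z|² ≤ 1`. [folklore] -/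
theorem gnomonicW_ge_of_le_one (v : Fin 3 → ℝ) (h : normSq3 v ≤ 1) : 2 * normSq3 v ≤ gnomonicW v := by
  have h0 := normSq3_nonneg v
  rw [gnomonicW, le_div_iff₀ (by linarith)]
  nlinarith

/-- The letter sizes of the fibre direction `ξ(w)` are `≤ √N(w)`. [folklore] -/
theorem letterSizes_fibreDir_le (w : ((Fin 2 → ℝ) × (Fin 2 → ℝ)) × (Fin 3 → ℝ) × (Fol L → Fin 3 → ℝ)) :
    Real.sqrt (∑ k, (![0, w.1.1 0, w.1.1 1] : Fin 3 → ℝ) k ^ 2) ≤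
        Real.sqrt (w.1.1 0 ^ 2 + w.1.1 1 ^ 2 + (w.1.2 0 ^ 2 + w.1.2 1 ^ 2) + normSq3 w.2.1 + ∑ f, normSq3 (w.2.2 f)) ∧
      Real.sqrt (∑ k, (![0, w.1.2 0, w.1.2 1] : Fin 3 → ℝ) k ^ 2) ≤
        Real.sqrt (w.1.1 0 ^ 2 + w.1.1 1 ^ 2 + (w.1.2 0 ^ 2 + w.1.2 1 ^ 2) + normSq3 w.2.1 + ∑ f, normSq3 (w.2.2 f)) ∧
      Real.sqrt (∑ k, w.2.1 k ^ 2) ≤ Real.sqrt (w.1.1 0 ^ 2 + w.1.1 1 ^ 2 + (w.1.2 0 ^ 2 + w.1.2 1 ^ 2) + normSq3 w.2.1 + ∑ f, normSq3 (w.2.2 f)) ∧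
      ∀ i, Real.sqrt (∑ k, w.2.2 i k ^ 2) ≤ Real.sqrt (w.1.1 0 ^ 2 + w.1.1 1 ^ 2 + (w.1.2 0 ^ 2 + w.1.2 1 ^ 2) + normSq3 w.2.1 + ∑ f, normSq3 (w.2.2 f)) := by
  have h1 := normSq3_nonneg w.2.1
  have h2 : 0 ≤ ∑ f, normSq3 (w.2.2 f) := Finset.sum_nonneg fun f _ => normSq3_nonneg _
  have hz : ∑ k, w.2.1 k ^ 2 = normSq3 w.2.1 := rfl
  refine ⟨Real.sqrt_le_sqrt ?_, Real.sqrt_le_sqrt ?_, Real.sqrt_le_sqrt ?_, fun i => Real.sqrt_le_sqrt ?_⟩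
  · simp only [Fin.sum_univ_three, Matrix.cons_val_zero, Matrix.cons_val_one, Matrix.cons_val_two, Matrix.head_cons, Matrix.tail_cons]
    nlinarith [sq_nonneg (w.1.2 0), sq_nonneg (w.1.2 1)]
  · simp only [Fin.sum_univ_three, Matrix.cons_val_zero, Matrix.cons_val_one, Matrix.cons_val_two, Matrix.head_cons, Matrix.tail_cons]
    nlinarith [sq_nonneg (w.1.1 0), sq_nonneg (w.1.1 1)]
  · rw [hz]; nlinarith [sq_nonneg (w.1.1 0), sq_nonneg (w.1.1 1), sq_nonneg (w.1.2 0), sq_nonneg (w.1.2 1)]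
  · have hi : ∑ k, w.2.2 i k ^ 2 = normSq3 (w.2.2 i) := rfl
    rw [hi]
    have := Finset.single_le_sum (fun g _ => normSq3_nonneg (w.2.2 g)) (Finset.mem_univ i)
    nlinarith [sq_nonneg (w.1.1 0), sq_nonneg (w.1.1 1), sq_nonneg (w.1.2 0), sq_nonneg (w.1.2 1)]

/-! ## §2 Growth along the fibre -/
set_option maxHeartbeats 400000 in
/-- ★★ **GROWTH ALONG THE FIBRE** (principal sector): at the point `η₀ + ξ(w)` with `N(w) ≤ 1`, for any `μ′` below the four halved constants
`κ_x/2 = 2s₂ψ²/((2+x₀²)·16200L⁶)`, `κ_y/2 = 2sψ²/((2+y₀²)·16200L⁶)`, `κ_z/2 = 1/16200L⁶`, `κ_F/2 = 1/(2·2304L⁶|Fol L|)` (`s₂ψ = 2(a.re/‖a‖)(‖a.im‖/‖a‖)`, `sψ = ‖a.im‖/‖a‖`):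
`μ′·N(w) ≤ F̂(η₀ + ξ(w))`. [cite: Luscher1983, §2] -/
theorem fibre_growth_gnomonic {a : ℍ} (ha : a ≠ 0) (ε : GnoSign L) (hε : ε.2.2 = fun _ => true) (x₀ y₀ : ℝ) {μ' : ℝ}
    (hμx : μ' ≤ 2 * (2 * (‖a‖⁻¹ * a.re) * (‖a‖⁻¹ * ‖a.im‖)) ^ 2 / ((2 + x₀ ^ 2) * (16200 * (L : ℝ) ^ 6)))
    (hμy : μ' ≤ 2 * (‖a‖⁻¹ * ‖a.im‖) ^ 2 / ((2 + y₀ ^ 2) * (16200 * (L : ℝ) ^ 6)))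
    (hμz : μ' ≤ 1 / (16200 * (L : ℝ) ^ 6))
    (hμF : μ' ≤ (2304 * (L : ℝ) ^ 6 * (Fintype.card (Fol L) : ℝ))⁻¹ / 2)
    (w : ((Fin 2 → ℝ) × (Fin 2 → ℝ)) × (Fin 3 → ℝ) × (Fol L → Fin 3 → ℝ))
    (hw : w.1.1 0 ^ 2 + w.1.1 1 ^ 2 + (w.1.2 0 ^ 2 + w.1.2 1 ^ 2) + normSq3 w.2.1 + ∑ f, normSq3 (w.2.2 f) ≤ 1) :
    μ' * (w.1.1 0 ^ 2 + w.1.1 1 ^ 2 + (w.1.2 0 ^ 2 + w.1.2 1 ^ 2) + normSq3 w.2.1 + ∑ f, normSq3 (w.2.2 f)) ≤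
      gnoDeficit (fun _ => false) (fun _ => 1) a ε
        ((((![x₀, 0, 0] : Fin 3 → ℝ), (![y₀, 0, 0] : Fin 3 → ℝ)), ((0 : Fin 3 → ℝ), (0 : Fol L → Fin 3 → ℝ))) +
          (((![0, w.1.1 0, w.1.1 1] : Fin 3 → ℝ), (![0, w.1.2 0, w.1.2 1] : Fin 3 → ℝ)), (w.2.1, w.2.2))) := by
  set η : GnoCoord L := ((((![x₀, 0, 0] : Fin 3 → ℝ), (![y₀, 0, 0] : Fin 3 → ℝ)), ((0 : Fin 3 → ℝ), (0 : Fol L → Fin 3 → ℝ))) +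
    (((![0, w.1.1 0, w.1.1 1] : Fin 3 → ℝ), (![0, w.1.2 0, w.1.2 1] : Fin 3 → ℝ)), (w.2.1, w.2.2))) with hηdef
  have hη11 : η.1.1 = ![x₀, w.1.1 0, w.1.1 1] := by
    simp only [hηdef, Prod.fst_add]; funext k; fin_cases k <;> simp
  have hη12 : η.1.2 = ![y₀, w.1.2 0, w.1.2 1] := by
    simp only [hηdef, Prod.fst_add, Prod.snd_add]; funext k; fin_cases k <;> simp
  have hη21 : η.2.1 = w.2.1 := by simp only [hηdef, Prod.snd_add, Prod.fst_add, zero_add]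
  have hη22 : η.2.2 = w.2.2 := by simp only [hηdef, Prod.snd_add, zero_add]
  have hL : (0 : ℝ) < L := by exact_mod_cast NeZero.pos L
  -- non-negativity of the pieces
  have hu0 : 0 ≤ w.1.1 0 ^ 2 + w.1.1 1 ^ 2 := by positivity
  have hv0 : 0 ≤ w.1.2 0 ^ 2 + w.1.2 1 ^ 2 := by positivity
  have hz0 := normSq3_nonneg w.2.1
  have hF0 : 0 ≤ ∑ f, normSq3 (w.2.2 f) := Finset.sum_nonneg fun f _ => normSq3_nonneg _
  -- leaders: hub stiffness with the homogeneous minorants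
  have hlead := leadersW_hubStiff_le (L := L) ha ε η
  rw [hη11, hη12, hη21] at hlead
  have hx := gnoWtr_ge_of_le_one x₀ (w.1.1 0) (w.1.1 1) (by linarith)
  have hy := gnoWtr_ge_of_le_one y₀ (w.1.2 0) (w.1.2 1) (by linarith)
  have hz := gnomonicW_ge_of_le_one w.2.1 (by linarith)
  have hcx : 0 ≤ (2 * (‖a‖⁻¹ * a.re) * (‖a‖⁻¹ * ‖a.im‖)) ^ 2 := sq_nonneg _
  have hcy : 0 ≤ (‖a‖⁻¹ * ‖a.im‖) ^ 2 := sq_nonneg _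
  -- followers
  have hgno : gnoDeficit (fun _ => false) (fun _ => 1) a ε η =
      chartDeficit L (fun _ => false) (fun _ => 1) ((blowUpPoint 1 (gnomonicPoint a ε η)).1, fun f => quatToSU2 (gnoLetter true (w.2.2 f))) := by
    unfold gnoDeficit
    congr 1
    refine Prod.ext rfl ?_
    funext f
    rw [blowUpPoint_one_gnomonicPoint_snd, hε, hη22]
  have hbox : ∀ f, normSq3 (w.2.2 f) ≤ 1 := fun f =>
    le_trans (Finset.single_le_sum (fun g _ => normSq3_nonneg (w.2.2 g)) (Finset.mem_univ f)) (by linarith)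
  have hfol := gnoFollower_growth (L := L) (blowUpPoint 1 (gnomonicPoint a ε η)).1 w.2.2 hbox
  rw [← hgno] at hfol
  set F := gnoDeficit (fun _ => false) (fun _ => 1) a ε η with hFdef
  -- the four pieces
  have hden_x : 0 < (2 + x₀ ^ 2) * (16200 * (L : ℝ) ^ 6) := by positivity
  have hden_y : 0 < (2 + y₀ ^ 2) * (16200 * (L : ℝ) ^ 6) := by positivity
  have hK : 0 < 16200 * (L : ℝ) ^ 6 := by positivity
  have hKF : 0 < 2304 * (L : ℝ) ^ 6 * (Fintype.card (Fol L) : ℝ) := by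
    have hcard : 0 < Fintype.card (Fol L) := by rw [card_fol]; have := Nat.one_le_pow 4 L NeZero.one_le; omega
    positivity
  -- piece x: `μ′·|u|² ≤ (κ_x/2)|u|² ≤ s₂ψ²·gnoWtr/(2·16200L⁶)`
  have px : μ' * (w.1.1 0 ^ 2 + w.1.1 1 ^ 2) ≤ (2 * (‖a‖⁻¹ * a.re) * (‖a‖⁻¹ * ‖a.im‖)) ^ 2 * gnoWtr (![x₀, w.1.1 0, w.1.1 1] : Fin 3 → ℝ) /
      (2 * (16200 * (L : ℝ) ^ 6)) := by
    have h1 : μ' * (w.1.1 0 ^ 2 + w.1.1 1 ^ 2) ≤ 2 * (2 * (‖a‖⁻¹ * a.re) * (‖a‖⁻¹ * ‖a.im‖)) ^ 2 / ((2 + x₀ ^ 2) * (16200 * (L : ℝ) ^ 6)) *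
        (w.1.1 0 ^ 2 + w.1.1 1 ^ 2) := mul_le_mul_of_nonneg_right hμx hu0
    have h2 : 2 * (2 * (‖a‖⁻¹ * a.re) * (‖a‖⁻¹ * ‖a.im‖)) ^ 2 / ((2 + x₀ ^ 2) * (16200 * (L : ℝ) ^ 6)) * (w.1.1 0 ^ 2 + w.1.1 1 ^ 2) =
        (2 * (‖a‖⁻¹ * a.re) * (‖a‖⁻¹ * ‖a.im‖)) ^ 2 * (4 * (w.1.1 0 ^ 2 + w.1.1 1 ^ 2) / (2 + x₀ ^ 2)) / (2 * (16200 * (L : ℝ) ^ 6)) := by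
      field_simp; ring
    rw [h2] at h1
    exact h1.trans (div_le_div_of_nonneg_right (mul_le_mul_of_nonneg_left hx hcx) (by positivity))
  have py : μ' * (w.1.2 0 ^ 2 + w.1.2 1 ^ 2) ≤ (‖a‖⁻¹ * ‖a.im‖) ^ 2 * gnoWtr (![y₀, w.1.2 0, w.1.2 1] : Fin 3 → ℝ) / (2 * (16200 * (L : ℝ) ^ 6)) := by
    have h1 : μ' * (w.1.2 0 ^ 2 + w.1.2 1 ^ 2) ≤ 2 * (‖a‖⁻¹ * ‖a.im‖) ^ 2 / ((2 + y₀ ^ 2) * (16200 * (L : ℝ) ^ 6)) * (w.1.2 0 ^ 2 + w.1.2 1 ^ 2) :=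
      mul_le_mul_of_nonneg_right hμy hv0
    have h2 : 2 * (‖a‖⁻¹ * ‖a.im‖) ^ 2 / ((2 + y₀ ^ 2) * (16200 * (L : ℝ) ^ 6)) * (w.1.2 0 ^ 2 + w.1.2 1 ^ 2) =
        (‖a‖⁻¹ * ‖a.im‖) ^ 2 * (4 * (w.1.2 0 ^ 2 + w.1.2 1 ^ 2) / (2 + y₀ ^ 2)) / (2 * (16200 * (L : ℝ) ^ 6)) := by
      field_simp; ring
    rw [h2] at h1
    exact h1.trans (div_le_div_of_nonneg_right (mul_le_mul_of_nonneg_left hy hcy) (by positivity))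
  have pz : μ' * normSq3 w.2.1 ≤ gnomonicW w.2.1 / (2 * (16200 * (L : ℝ) ^ 6)) := by
    have h1 : μ' * normSq3 w.2.1 ≤ 1 / (16200 * (L : ℝ) ^ 6) * normSq3 w.2.1 := mul_le_mul_of_nonneg_right hμz hz0
    have h2 : 1 / (16200 * (L : ℝ) ^ 6) * normSq3 w.2.1 = 2 * normSq3 w.2.1 / (2 * (16200 * (L : ℝ) ^ 6)) := by field_simp
    rw [h2] at h1
    exact h1.trans (div_le_div_of_nonneg_right hz (by positivity))
  have pF : μ' * ∑ f, normSq3 (w.2.2 f) ≤ F / 2 := by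
    have h1 : μ' * ∑ f, normSq3 (w.2.2 f) ≤ (2304 * (L : ℝ) ^ 6 * (Fintype.card (Fol L) : ℝ))⁻¹ / 2 * ∑ f, normSq3 (w.2.2 f) :=
      mul_le_mul_of_nonneg_right hμF hF0
    have h2 : (2304 * (L : ℝ) ^ 6 * (Fintype.card (Fol L) : ℝ))⁻¹ / 2 * ∑ f, normSq3 (w.2.2 f) =
        ((2304 * (L : ℝ) ^ 6 * (Fintype.card (Fol L) : ℝ))⁻¹ * ∑ f, normSq3 (w.2.2 f)) / 2 := by ring
    rw [h2] at h1
    exact h1.trans (by linarith)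
  -- sum: leaders' three pieces `≤ F/2`
  have hleadsum : (2 * (‖a‖⁻¹ * a.re) * (‖a‖⁻¹ * ‖a.im‖)) ^ 2 * gnoWtr (![x₀, w.1.1 0, w.1.1 1] : Fin 3 → ℝ) / (2 * (16200 * (L : ℝ) ^ 6)) +
      (‖a‖⁻¹ * ‖a.im‖) ^ 2 * gnoWtr (![y₀, w.1.2 0, w.1.2 1] : Fin 3 → ℝ) / (2 * (16200 * (L : ℝ) ^ 6)) +
      gnomonicW w.2.1 / (2 * (16200 * (L : ℝ) ^ 6)) ≤ F / 2 := by
    have hlead' : (2 * (‖a‖⁻¹ * a.re) * (‖a‖⁻¹ * ‖a.im‖)) ^ 2 * gnoWtr (![x₀, w.1.1 0, w.1.1 1] : Fin 3 → ℝ) +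
        (‖a‖⁻¹ * ‖a.im‖) ^ 2 * gnoWtr (![y₀, w.1.2 0, w.1.2 1] : Fin 3 → ℝ) + gnomonicW w.2.1 ≤ 16200 * (L : ℝ) ^ 6 * F := hlead
    rw [← add_div, ← add_div, div_le_div_iff₀ (by positivity) (by norm_num : (0 : ℝ) < 2)]
    nlinarith [hlead']
  calc μ' * (w.1.1 0 ^ 2 + w.1.1 1 ^ 2 + (w.1.2 0 ^ 2 + w.1.2 1 ^ 2) + normSq3 w.2.1 + ∑ f, normSq3 (w.2.2 f))
      = μ' * (w.1.1 0 ^ 2 + w.1.1 1 ^ 2) + μ' * (w.1.2 0 ^ 2 + w.1.2 1 ^ 2) + μ' * normSq3 w.2.1 + μ' * ∑ f, normSq3 (w.2.2 f) := by ring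
    _ ≤ F / 2 + F / 2 := by linarith [px, py, pz, pF, hleadsum]
    _ = F := by ring


/-! ## §3 The quartic ray remainder and the coercivity of the full fibre Hessian -/

/-- The rays of the gnomonic deficit through `η₀` are `C^∞`. [folklore] -/
theorem contDiff_gnoDeficit_ray (z : Fin 3 → Bool) (χ : Site 3 L → SU2) {a : ℍ} (ha : a ≠ 0) (ε : GnoSign L) (η₀ ζ : GnoCoord L) {n : ℕ∞} :
    ContDiff ℝ n (fun s : ℝ => gnoDeficit z χ a ε (η₀ + s • ζ)) :=
  (contDiff_gnoDeficit (n := n) z χ ha ε).comp (contDiff_const.add (contDiff_id.smul contDiff_const))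

omit [NeZero L] in
/-- The zero fibre direction. [folklore] -/
theorem fibreDir_zero :
    ((((![0, 0, 0] : Fin 3 → ℝ), (![0, 0, 0] : Fin 3 → ℝ)), ((0 : Fin 3 → ℝ), (0 : Fol L → Fin 3 → ℝ))) : GnoCoord L) = 0 := by
  refine Prod.ext (Prod.ext ?_ ?_) (Prod.ext rfl rfl)
  · funext k; fin_cases k <;> rfl
  · funext k; fin_cases k <;> rfl

/-- ★★ **THE QUARTIC RAY REMAINDER ALONG A FIBRE DIRECTION**: `≤ 63540000·L⁴·N(w)²` (✓`taylor_four_gnoDeficit_line` with letter size `√N(w)`). [cite: Luscher1983, §2] -/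
theorem fibre_ray_remainder_four (z : Fin 3 → Bool) (χ : Site 3 L → SU2) {a : ℍ} (ha : a ≠ 0) (ε : GnoSign L) (x₀ y₀ : ℝ)
    (w : ((Fin 2 → ℝ) × (Fin 2 → ℝ)) × (Fin 3 → ℝ) × (Fol L → Fin 3 → ℝ)) :
    |gnoDeficit z χ a ε (((((![x₀, 0, 0] : Fin 3 → ℝ), (![y₀, 0, 0] : Fin 3 → ℝ)), ((0 : Fin 3 → ℝ), (0 : Fol L → Fin 3 → ℝ))) : GnoCoord L) + (((![0, w.1.1 0, w.1.1 1] : Fin 3 → ℝ), (![0, w.1.2 0, w.1.2 1] : Fin 3 → ℝ)), (w.2.1, w.2.2))) - gnoDeficit z χ a ε ((((![x₀, 0, 0] : Fin 3 → ℝ), (![y₀, 0, 0] : Fin 3 → ℝ)), ((0 : Fin 3 → ℝ), (0 : Fol L → Fin 3 → ℝ))) : GnoCoord L) -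
        deriv (fun s : ℝ => gnoDeficit z χ a ε (((((![x₀, 0, 0] : Fin 3 → ℝ), (![y₀, 0, 0] : Fin 3 → ℝ)), ((0 : Fin 3 → ℝ), (0 : Fol L → Fin 3 → ℝ))) : GnoCoord L) + s • (((![0, w.1.1 0, w.1.1 1] : Fin 3 → ℝ), (![0, w.1.2 0, w.1.2 1] : Fin 3 → ℝ)), (w.2.1, w.2.2)))) 0 -
        iteratedDeriv 2 (fun s : ℝ => gnoDeficit z χ a ε (((((![x₀, 0, 0] : Fin 3 → ℝ), (![y₀, 0, 0] : Fin 3 → ℝ)), ((0 : Fin 3 → ℝ), (0 : Fol L → Fin 3 → ℝ))) : GnoCoord L) + s • (((![0, w.1.1 0, w.1.1 1] : Fin 3 → ℝ), (![0, w.1.2 0, w.1.2 1] : Fin 3 → ℝ)), (w.2.1, w.2.2)))) 0 / 2 -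
        iteratedDeriv 3 (fun s : ℝ => gnoDeficit z χ a ε (((((![x₀, 0, 0] : Fin 3 → ℝ), (![y₀, 0, 0] : Fin 3 → ℝ)), ((0 : Fin 3 → ℝ), (0 : Fol L → Fin 3 → ℝ))) : GnoCoord L) + s • (((![0, w.1.1 0, w.1.1 1] : Fin 3 → ℝ), (![0, w.1.2 0, w.1.2 1] : Fin 3 → ℝ)), (w.2.1, w.2.2)))) 0 / 6| ≤
      63540000 * (L : ℝ) ^ 4 * (w.1.1 0 ^ 2 + w.1.1 1 ^ 2 + (w.1.2 0 ^ 2 + w.1.2 1 ^ 2) + normSq3 w.2.1 + ∑ f, normSq3 (w.2.2 f)) ^ 2 := by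
  set S : ℝ := Real.sqrt (w.1.1 0 ^ 2 + w.1.1 1 ^ 2 + (w.1.2 0 ^ 2 + w.1.2 1 ^ 2) + normSq3 w.2.1 + ∑ f, normSq3 (w.2.2 f)) with hS
  have hN0 := fibreGauge_nonneg (L := L) w
  have hS0 : 0 ≤ S := Real.sqrt_nonneg _
  obtain ⟨hx, hy, hz, hf⟩ := letterSizes_fibreDir_le (L := L) w
  obtain ⟨-, -, h4⟩ := taylor_four_gnoDeficit_line z χ ha ε ((((![x₀, 0, 0] : Fin 3 → ℝ), (![y₀, 0, 0] : Fin 3 → ℝ)), ((0 : Fin 3 → ℝ), (0 : Fol L → Fin 3 → ℝ))) : GnoCoord L) ((((![0, w.1.1 0, w.1.1 1] : Fin 3 → ℝ), (![0, w.1.2 0, w.1.2 1] : Fin 3 → ℝ)), (w.2.1, w.2.2)) : GnoCoord L) hS0 hx hy hz hf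
  have hS4 : S ^ 4 = (w.1.1 0 ^ 2 + w.1.1 1 ^ 2 + (w.1.2 0 ^ 2 + w.1.2 1 ^ 2) + normSq3 w.2.1 + ∑ f, normSq3 (w.2.2 f)) ^ 2 := by
    rw [show (4 : ℕ) = 2 * 2 from rfl, pow_mul, hS, Real.sq_sqrt hN0]
  calc _ ≤ 381240000 * (L : ℝ) ^ 4 * S ^ 4 / 6 := h4
    _ = 63540000 * (L : ℝ) ^ 4 * (w.1.1 0 ^ 2 + w.1.1 1 ^ 2 + (w.1.2 0 ^ 2 + w.1.2 1 ^ 2) + normSq3 w.2.1 + ∑ f, normSq3 (w.2.2 f)) ^ 2 := by rw [hS4]; ring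

/-- ★★★ **THE FULL FIBRE HESSIAN AT A GNOMONIC BASE POINT IS COERCIVE** (principal sector, ray form).  Hub `a ≠ 0`, follower signs `+`, base point
`η₀ = ((x₀e₀, y₀e₀), 0, 0)`; any `μ′` below the four halved growth constants of ✓`fibre_growth_gnomonic`; `0 < R ≤ 1` with `2·F̂(η₀) ≤ μ′R²/2` (void on the exactly
flat base) and `2·63540000L⁴·R² ≤ μ′/2`.  Then for EVERY fibre direction `w = ((u,v),z,η_F)`:
`μ′·N(w) ≤ (d²/ds²) gnoDeficit 0 1 a ε (η₀ + s·ξ(w))|₀`, `N(w) = |u|² + |v|² + |z|² + Σ|η_f|²`. [cite: Luscher1983, §2] -/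
theorem fibre_raySecond_coercive_gnomonic {a : ℍ} (ha : a ≠ 0) (ε : GnoSign L) (hε : ε.2.2 = fun _ => true) (x₀ y₀ : ℝ) {μ' R : ℝ}
    (hR : 0 < R) (hR1 : R ≤ 1)
    (hμx : μ' ≤ 2 * (2 * (‖a‖⁻¹ * a.re) * (‖a‖⁻¹ * ‖a.im‖)) ^ 2 / ((2 + x₀ ^ 2) * (16200 * (L : ℝ) ^ 6)))
    (hμy : μ' ≤ 2 * (‖a‖⁻¹ * ‖a.im‖) ^ 2 / ((2 + y₀ ^ 2) * (16200 * (L : ℝ) ^ 6)))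
    (hμz : μ' ≤ 1 / (16200 * (L : ℝ) ^ 6))
    (hμF : μ' ≤ (2304 * (L : ℝ) ^ 6 * (Fintype.card (Fol L) : ℝ))⁻¹ / 2)
    (hsmall₁ : 2 * gnoDeficit (fun _ => false) (fun _ => 1) a ε ((((![x₀, 0, 0] : Fin 3 → ℝ), (![y₀, 0, 0] : Fin 3 → ℝ)), ((0 : Fin 3 → ℝ), (0 : Fol L → Fin 3 → ℝ))) : GnoCoord L) ≤ μ' * R ^ 2 / 2)
    (hsmall₂ : 2 * (63540000 * (L : ℝ) ^ 4) * R ^ 2 ≤ μ' / 2)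
    (w : ((Fin 2 → ℝ) × (Fin 2 → ℝ)) × (Fin 3 → ℝ) × (Fol L → Fin 3 → ℝ)) :
    μ' * (w.1.1 0 ^ 2 + w.1.1 1 ^ 2 + (w.1.2 0 ^ 2 + w.1.2 1 ^ 2) + normSq3 w.2.1 + ∑ f, normSq3 (w.2.2 f)) ≤
      iteratedDeriv 2 (fun s : ℝ => gnoDeficit (fun _ => false) (fun _ => 1) a ε (((((![x₀, 0, 0] : Fin 3 → ℝ), (![y₀, 0, 0] : Fin 3 → ℝ)), ((0 : Fin 3 → ℝ), (0 : Fol L → Fin 3 → ℝ))) : GnoCoord L) + s • (((![0, w.1.1 0, w.1.1 1] : Fin 3 → ℝ), (![0, w.1.2 0, w.1.2 1] : Fin 3 → ℝ)), (w.2.1, w.2.2)))) 0 := by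
  -- the ambient function through `η₀`, the chart of fibre directions, the three functions of the gauge lemma
  set η₀ : GnoCoord L := ((((![x₀, 0, 0] : Fin 3 → ℝ), (![y₀, 0, 0] : Fin 3 → ℝ)), ((0 : Fin 3 → ℝ), (0 : Fol L → Fin 3 → ℝ))) : GnoCoord L) with hη₀
  set Fg : GnoCoord L → ℝ := fun ζ => gnoDeficit (fun _ => false) (fun _ => 1) a ε (η₀ + ζ) with hFg
  set ξ : (((Fin 2 → ℝ) × (Fin 2 → ℝ)) × (Fin 3 → ℝ) × (Fol L → Fin 3 → ℝ)) → GnoCoord L :=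
    fun w => (((![0, w.1.1 0, w.1.1 1] : Fin 3 → ℝ), (![0, w.1.2 0, w.1.2 1] : Fin 3 → ℝ)), (w.2.1, w.2.2)) with hξ
  set N : (((Fin 2 → ℝ) × (Fin 2 → ℝ)) × (Fin 3 → ℝ) × (Fol L → Fin 3 → ℝ)) → ℝ := fun w => (w.1.1 0 ^ 2 + w.1.1 1 ^ 2 + (w.1.2 0 ^ 2 + w.1.2 1 ^ 2) + normSq3 w.2.1 + ∑ f, normSq3 (w.2.2 f)) with hN
  set F : (((Fin 2 → ℝ) × (Fin 2 → ℝ)) × (Fin 3 → ℝ) × (Fol L → Fin 3 → ℝ)) → ℝ := fun w => Fg (ξ w) with hF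
  set Q : (((Fin 2 → ℝ) × (Fin 2 → ℝ)) × (Fin 3 → ℝ) × (Fol L → Fin 3 → ℝ)) → ℝ := fun w => iteratedDeriv 2 (fun s : ℝ => Fg (s • ξ w)) 0 with hQ
  have hξs : ∀ (t : ℝ) (w' : ((Fin 2 → ℝ) × (Fin 2 → ℝ)) × (Fin 3 → ℝ) × (Fol L → Fin 3 → ℝ)), ξ (t • w') = t • ξ w' := fun t w' => fibreDir_smul (L := L) t w'
  have hξ0 : ξ 0 = 0 := by
    have h := hξs 0 0
    rw [zero_smul, zero_smul] at h; exact h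
  have hξn : ∀ w', ξ (-w') = -ξ w' := fun w' => by
    have h := hξs (-1) w'
    rw [neg_one_smul, neg_one_smul] at h; exact h
  have hray : ∀ w', (fun s : ℝ => gnoDeficit (fun _ => false) (fun _ => 1) a ε (η₀ + s • ξ w')) = fun s => Fg (s • ξ w') := fun w' => rfl
  have hsmooth : ∀ ζ : GnoCoord L, ContDiff ℝ 2 (fun s : ℝ => Fg (s • ζ)) := fun ζ => contDiff_gnoDeficit_ray (n := 2) _ _ ha ε η₀ ζ
  have hF0 : F 0 = gnoDeficit (fun _ => false) (fun _ => 1) a ε η₀ := by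
    show Fg (ξ 0) = _
    rw [hξ0]; simp only [hFg, add_zero]
  -- hypotheses of the gauge lemma
  have hNh : ∀ (t : ℝ) (w' : ((Fin 2 → ℝ) × (Fin 2 → ℝ)) × (Fin 3 → ℝ) × (Fol L → Fin 3 → ℝ)), N (t • w') = t ^ 2 * N w' :=
    fun t w' => fibreGauge_smul (L := L) t w'
  have hQh : ∀ (t : ℝ) (w' : ((Fin 2 → ℝ) × (Fin 2 → ℝ)) × (Fin 3 → ℝ) × (Fol L → Fin 3 → ℝ)), Q (t • w') = t ^ 2 * Q w' := by
    intro t w'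
    show iteratedDeriv 2 (fun s : ℝ => Fg (s • ξ (t • w'))) 0 = t ^ 2 * iteratedDeriv 2 (fun s : ℝ => Fg (s • ξ w')) 0
    rw [hξs]; exact raySecond_homogeneous hsmooth t (ξ w')
  have hN0 : ∀ w', 0 ≤ N w' := fun w' => fibreGauge_nonneg (L := L) w'
  have hNdef : ∀ w', N w' = 0 → w' = 0 := fun w' h => eq_zero_of_fibreGauge_eq_zero (L := L) w' h
  have hgrowth : ∀ w', N w' ≤ R ^ 2 → μ' * N w' ≤ F w' := fun w' hw' =>
    fibre_growth_gnomonic (L := L) ha ε hε x₀ y₀ hμx hμy hμz hμF w' (hw'.trans (by nlinarith))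
  have hT : ∃ σ : (((Fin 2 → ℝ) × (Fin 2 → ℝ)) × (Fin 3 → ℝ) × (Fol L → Fin 3 → ℝ)) → ℝ, (∀ w', σ (-w') = -σ w') ∧
      ∀ w', N w' ≤ R ^ 2 → |F w' - gnoDeficit (fun _ => false) (fun _ => 1) a ε η₀ - (1 / 2) * Q w' - σ w'| ≤ 63540000 * (L : ℝ) ^ 4 * N w' ^ 2 := by
    refine ⟨fun w' => (F w' - F (-w')) / 2, fun w' => by simp only [neg_neg]; ring, fun w' _ => ?_⟩
    have hyn : N (-w') = N w' := by rw [show -w' = (-1 : ℝ) • w' by simp, hNh]; norm_num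
    have hp' := fibre_ray_remainder_four (L := L) (fun _ => false) (fun _ => 1) ha ε x₀ y₀ w'
    have hm' := fibre_ray_remainder_four (L := L) (fun _ => false) (fun _ => 1) ha ε x₀ y₀ (-w')
    -- read both remainders through `Fg`, `ξ`
    have ep : gnoDeficit (fun _ => false) (fun _ => 1) a ε (η₀ + ξ w') = F w' := rfl
    have em : gnoDeficit (fun _ => false) (fun _ => 1) a ε (η₀ + ξ (-w')) = F (-w') := rfl
    change |gnoDeficit (fun _ => false) (fun _ => 1) a ε (η₀ + ξ w') - gnoDeficit (fun _ => false) (fun _ => 1) a ε η₀ -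
        deriv (fun s : ℝ => gnoDeficit (fun _ => false) (fun _ => 1) a ε (η₀ + s • ξ w')) 0 -
        iteratedDeriv 2 (fun s : ℝ => gnoDeficit (fun _ => false) (fun _ => 1) a ε (η₀ + s • ξ w')) 0 / 2 -
        iteratedDeriv 3 (fun s : ℝ => gnoDeficit (fun _ => false) (fun _ => 1) a ε (η₀ + s • ξ w')) 0 / 6| ≤ 63540000 * (L : ℝ) ^ 4 * N w' ^ 2 at hp'
    change |gnoDeficit (fun _ => false) (fun _ => 1) a ε (η₀ + ξ (-w')) - gnoDeficit (fun _ => false) (fun _ => 1) a ε η₀ -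
        deriv (fun s : ℝ => gnoDeficit (fun _ => false) (fun _ => 1) a ε (η₀ + s • ξ (-w'))) 0 -
        iteratedDeriv 2 (fun s : ℝ => gnoDeficit (fun _ => false) (fun _ => 1) a ε (η₀ + s • ξ (-w'))) 0 / 2 -
        iteratedDeriv 3 (fun s : ℝ => gnoDeficit (fun _ => false) (fun _ => 1) a ε (η₀ + s • ξ (-w'))) 0 / 6| ≤ 63540000 * (L : ℝ) ^ 4 * N (-w') ^ 2 at hm'
    rw [hray, ep] at hp'
    rw [hray, em, hξn, hyn] at hm'
    have e1 := deriv_ray_neg Fg (ξ w')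
    have e2 := iteratedDeriv_two_ray_neg Fg (ξ w')
    have e3 := iteratedDeriv_three_ray_neg Fg (ξ w')
    rw [e1, e2, e3] at hm'
    have hp := abs_le.1 hp'
    have hm := abs_le.1 hm'
    change |F w' - gnoDeficit (fun _ => false) (fun _ => 1) a ε η₀ - 1 / 2 * iteratedDeriv 2 (fun s : ℝ => Fg (s • ξ w')) 0 - (F w' - F (-w')) / 2| ≤
      63540000 * (L : ℝ) ^ 4 * N w' ^ 2
    rw [abs_le]
    constructor <;> linarith [hp.1, hp.2, hm.1, hm.2]
  have key := gauge_coercive_of_growth_offset_half (N := N) (Q := Q) (f := F) (μ := μ') (B₄ := 63540000 * (L : ℝ) ^ 4) (R := R)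
    (f₀ := gnoDeficit (fun _ => false) (fun _ => 1) a ε η₀) hR hNh hQh hN0 hNdef hgrowth hT hsmall₁ hsmall₂ w
  exact key

end Summit.QuantumFields.YangMills.Theorems.SwapVirialDeficit.BlowUpRing

end
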